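import Summits.AtomisticToContinuum.FouriersLaw.Theorems.BondHeatUncertaintySubdiffusiveBondHeatSiteEnergyDynkin
import Summits.AtomisticToContinuum.FouriersLaw.Theorems.OddSectorIrreversibilityConeScaleCorrectorStubGeneratorLeftEnergy
import Literature.Barriers.AtomisticToContinuum.MazurBoundBallisticOpenChain
import Literature.MathematicalPhysics.KineticTheory.PhaseSpacePoisson

/-!
# `ConeScaleCorrector` (E1), line `gamblers-ruin-defect`: stub `stub_dynkinLeftEnergy`, auxiliary estimates

Support file for the registered sub-stub `stub_dynkinLeftEnergy` (Dynkin's identity for `E_L = H − X/(N−1)` under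
the constructed equilibrium kernels of the pinned chain, by truncation), following the tree's precedent
`stub_siteEnergyDynkin` (file `BondHeatUncertaintySubdiffusiveBondHeatSiteEnergyDynkin.lean`) with the bath-site
energy `e₀` replaced by `E_L`:
* `0 ≤ X ≤ (N−1) H` (`pinnedChain_energyMoment_nonneg_le`), hence `0 ≤ E_L ≤ H` (`pinnedChain_leftEnergy_nonneg_le`);
* `∂_{p_i} E_L = (1 − i/(N−1)) p_i` (`partialP_leftEnergy`): `= p₀` at the left contact, `= 0` at the right one;
* `|L E_L| ≤ B (1 + H)²` (`pinnedChain_abs_generator_leftEnergy_le`, from the generator identity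
  `stub_generatorLeftEnergy : L E_L = w_L − J/(N−1)` and `|j_i| ≤ N (3+β)/2 (1 + H)²`);
* the truncation error `|L(E_L χ(H/R)) − χ(H/R) L E_L| ≤ (A/R)(1 + H)²`
  (`pinnedChain_abs_generator_truncLeftEnergy_sub_le`, via `generator_mul_smoothCutoff_hamiltonian`).
Nothing here closes an item.
-/

noncomputable section

open MeasureTheory ProbabilityTheory Filter Topology Set
open scoped ENNReal NNReal BigOperators
open Literature.MathematicalPhysics.KineticTheory.HeatConduction
open Literature.Barriers.AtomisticToContinuum.OpenChain

namespace Summit.AtomisticToContinuum.FouriersLaw.Theorems.OddSectorIrreversibility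

open Summit.AtomisticToContinuum.FouriersLaw.Theorems.SubdiffusiveBondHeat
open Literature.MathematicalPhysics.KineticTheory Literature.MathematicalPhysics.KineticTheory.HeatConduction.OscillatorChain


variable {ω₂ lam β γ : ℝ} {N : ℕ}

/-- `0 ≤ X ≤ (N − 1) H` for the energy first moment `X = ∑_k k h_k` of the pinned chain (`ω₂, lam, β ≥ 0`): the
site energies are nonnegative, carry weights `k ≤ N − 1` (sites) and `k + ½ ≤ N − 1` (bonds `(k, k+1)`), and sum
to `H`. [folklore] -/
theorem pinnedChain_energyMoment_nonneg_le (hω : 0 ≤ ω₂) (hl : 0 ≤ lam) (hβ : 0 ≤ β) (γ : ℝ) (N : ℕ)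
    (x : PhaseSpace N) :
    0 ≤ energyMoment (pinnedChain ω₂ lam β γ) N x ∧
      energyMoment (pinnedChain ω₂ lam β γ) N x ≤ ((N : ℝ) - 1) * (pinnedChain ω₂ lam β γ).hamiltonian N x := by
  have hU0 : ∀ q, 0 ≤ (pinnedChain ω₂ lam β γ).U q := fun q => by
    show 0 ≤ ω₂ * q ^ 2 / 2 + lam * q ^ 4 / 4; positivity
  have hV0 : ∀ r, 0 ≤ (pinnedChain ω₂ lam β γ).V r := fun r => by
    show 0 ≤ r ^ 2 / 2 + β * r ^ 4 / 4; positivity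
  unfold energyMoment OscillatorChain.hamiltonian
  constructor
  · refine add_nonneg (Finset.sum_nonneg fun k _ => ?_)
      (Finset.sum_nonneg fun k _ => Finset.sum_nonneg fun l _ => ?_)
    · exact mul_nonneg (Nat.cast_nonneg _) (add_nonneg (by positivity) (hU0 _))
    · split_ifs
      · exact mul_nonneg (by positivity) (hV0 _)
      · exact le_rfl
  · rw [mul_add, Finset.mul_sum, Finset.mul_sum]
    refine add_le_add (Finset.sum_le_sum fun k _ => ?_) (Finset.sum_le_sum fun k _ => ?_)
    · have hk : (k.val : ℝ) ≤ (N : ℝ) - 1 := by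
        have h1 : k.val + 1 ≤ N := k.isLt
        have h2 : ((k.val : ℕ) : ℝ) + 1 ≤ N := by exact_mod_cast h1
        linarith
      exact mul_le_mul_of_nonneg_right hk (add_nonneg (by positivity) (hU0 _))
    · rw [Finset.mul_sum]
      refine Finset.sum_le_sum fun l _ => ?_
      split_ifs with h
      · have hk : (k.val : ℝ) + 1 / 2 ≤ (N : ℝ) - 1 := by
          have h1 : k.val + 2 ≤ N := by have := l.isLt; omega
          have h2 : ((k.val : ℕ) : ℝ) + 2 ≤ N := by exact_mod_cast h1
          linarith
        exact mul_le_mul_of_nonneg_right hk (hV0 _)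
      · rw [mul_zero]

/-- `0 ≤ E_L ≤ H` for `E_L = H − X/(N − 1)`, `N ≥ 2` (`0 ≤ X ≤ (N − 1) H`). [folklore] -/
theorem pinnedChain_leftEnergy_nonneg_le (hω : 0 ≤ ω₂) (hl : 0 ≤ lam) (hβ : 0 ≤ β) (γ : ℝ) (hN : 2 ≤ N)
    (x : PhaseSpace N) :
    0 ≤ (pinnedChain ω₂ lam β γ).hamiltonian N x - energyMoment (pinnedChain ω₂ lam β γ) N x / ((N : ℝ) - 1) ∧
      (pinnedChain ω₂ lam β γ).hamiltonian N x - energyMoment (pinnedChain ω₂ lam β γ) N x / ((N : ℝ) - 1) ≤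
        (pinnedChain ω₂ lam β γ).hamiltonian N x := by
  obtain ⟨h0, h1⟩ := pinnedChain_energyMoment_nonneg_le hω hl hβ γ N x
  have hN1 : (0 : ℝ) < (N : ℝ) - 1 := by
    have : (2 : ℝ) ≤ N := by exact_mod_cast hN
    linarith
  constructor
  · rw [sub_nonneg, div_le_iff₀ hN1]; linarith
  · have := div_nonneg h0 hN1.le; linarith

/-- `∂_{p_i} E_L = (1 − i/(N − 1)) p_i` for `E_L = H − X/(N − 1)` and `C²` potentials
(`∂_{p_i} H = p_i`, `∂_{p_i} X = i p_i`). [folklore] -/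
theorem partialP_leftEnergy (P : OscillatorChain) (hU : ContDiff ℝ 2 P.U) (hV : ContDiff ℝ 2 P.V) (i : Fin N)
    (x : PhaseSpace N) :
    partialP i (fun y : PhaseSpace N => P.hamiltonian N y - energyMoment P N y / ((N : ℝ) - 1)) x =
      (1 - (i.val : ℝ) / ((N : ℝ) - 1)) * x.2 i := by
  have hH : Differentiable ℝ (P.hamiltonian N) := (P.contDiff_hamiltonian hU hV N).differentiable (by norm_num)
  have hX : Differentiable ℝ (energyMoment P N) :=
    (contDiff_energyMoment_of_contDiff P hU hV).differentiable (by norm_num)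
  have hcX : Differentiable ℝ (fun y : PhaseSpace N => (-(1 / ((N : ℝ) - 1))) * energyMoment P N y) :=
    hX.const_mul _
  have hE : (fun y : PhaseSpace N => P.hamiltonian N y - energyMoment P N y / ((N : ℝ) - 1)) =
      (P.hamiltonian N) + fun y => (-(1 / ((N : ℝ) - 1))) * energyMoment P N y := by
    funext y; simp only [Pi.add_apply]; ring
  rw [hE, partialP_add hH hcX, partialP_const_mul, partialP_hamiltonian, partialP_energyMoment]
  ring

/-- `|L E_L| ≤ B (1 + H)²` with `B = γ(NT + 2) + N² (3 + β)/2` (`N ≥ 2`, `γ, T ≥ 0`): by the generator identity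
`L E_L = w_L − J/(N − 1)` (`stub_generatorLeftEnergy`), `|w_L| ≤ γ(T + p₀²) ≤ γ(NT + 2H)` and
`|j_i| ≤ N (3 + β)/2 (1 + H)²`. [folklore] -/
theorem pinnedChain_abs_generator_leftEnergy_le (hω : 0 ≤ ω₂) (hl : 0 ≤ lam) (hβ : 0 ≤ β) (hγ : 0 ≤ γ) (hN : 2 ≤ N)
    {T : ℝ} (hT : 0 ≤ T) (x : PhaseSpace N) :
    |(pinnedChain ω₂ lam β γ).generator N T T
        (fun y : PhaseSpace N => (pinnedChain ω₂ lam β γ).hamiltonian N y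
          - energyMoment (pinnedChain ω₂ lam β γ) N y / ((N : ℝ) - 1)) x| ≤
      (γ * (N * T + 2) + N * (N * ((3 + β) / 2))) * (1 + (pinnedChain ω₂ lam β γ).hamiltonian N x) ^ 2 := by
  rw [stub_generatorLeftEnergy ω₂ lam β γ T N hN x]
  have hH0 : 0 ≤ (pinnedChain ω₂ lam β γ).hamiltonian N x := pinnedChain_hamiltonian_nonneg hω hl hβ γ N x
  have hU0 : ∀ q, 0 ≤ (pinnedChain ω₂ lam β γ).U q := fun q => by
    show 0 ≤ ω₂ * q ^ 2 / 2 + lam * q ^ 4 / 4; positivity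
  have hV0 : ∀ r, 0 ≤ (pinnedChain ω₂ lam β γ).V r := fun r => by
    show 0 ≤ r ^ 2 / 2 + β * r ^ 4 / 4; positivity
  have hkin : ∑ i, x.2 i ^ 2 / 2 ≤ (pinnedChain ω₂ lam β γ).hamiltonian N x :=
    (pinnedChain ω₂ lam β γ).kinetic_le_hamiltonian_of_nonneg hU0 hV0 N x
  have hj : ∀ i : Fin N, |(pinnedChain ω₂ lam β γ).bondCurrent N i x| ≤
      N * ((3 + β) / 2 * (1 + (pinnedChain ω₂ lam β γ).hamiltonian N x) ^ 2) := fun i =>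
    pinnedChain_abs_bondCurrent_le hω hl hβ γ N i x
  generalize (pinnedChain ω₂ lam β γ).hamiltonian N x = Hx at hH0 hkin hj ⊢
  have hN1 : (1 : ℝ) ≤ (N : ℝ) - 1 := by
    have : (2 : ℝ) ≤ N := by exact_mod_cast hN
    linarith
  -- the power of the left bath
  have h1 : |∑ i : Fin N, (if i.val = 0 then γ * (T - x.2 i ^ 2) else 0)| ≤ γ * (N * T + 2 * Hx) := by
    calc |∑ i : Fin N, (if i.val = 0 then γ * (T - x.2 i ^ 2) else 0)|
        ≤ ∑ i : Fin N, |(if i.val = 0 then γ * (T - x.2 i ^ 2) else 0)| := Finset.abs_sum_le_sum_abs _ _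
      _ ≤ ∑ i : Fin N, γ * (T + 2 * (x.2 i ^ 2 / 2)) := Finset.sum_le_sum fun i _ => by
          split_ifs
          · rw [abs_mul, abs_of_nonneg hγ]
            refine mul_le_mul_of_nonneg_left ?_ hγ
            rw [abs_le]; constructor <;> nlinarith [sq_nonneg (x.2 i)]
          · rw [abs_zero]; positivity
      _ = γ * (N * T + 2 * ∑ i : Fin N, x.2 i ^ 2 / 2) := by
          rw [← Finset.mul_sum, Finset.sum_add_distrib, Finset.sum_const, Finset.card_univ, Fintype.card_fin,
            nsmul_eq_mul, ← Finset.mul_sum]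
      _ ≤ γ * (N * T + 2 * Hx) := by gcongr
  -- the total current
  have h2 : |1 / ((N : ℝ) - 1) * ∑ i : Fin N, (pinnedChain ω₂ lam β γ).bondCurrent N i x| ≤
      N * (N * ((3 + β) / 2 * (1 + Hx) ^ 2)) := by
    rw [abs_mul, abs_of_nonneg (by positivity : (0 : ℝ) ≤ 1 / ((N : ℝ) - 1))]
    have hs : |∑ i : Fin N, (pinnedChain ω₂ lam β γ).bondCurrent N i x| ≤ N * (N * ((3 + β) / 2 * (1 + Hx) ^ 2)) :=
      calc |∑ i : Fin N, (pinnedChain ω₂ lam β γ).bondCurrent N i x|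
          ≤ ∑ i : Fin N, |(pinnedChain ω₂ lam β γ).bondCurrent N i x| := Finset.abs_sum_le_sum_abs _ _
        _ ≤ ∑ _i : Fin N, N * ((3 + β) / 2 * (1 + Hx) ^ 2) := Finset.sum_le_sum fun i _ => hj i
        _ = N * (N * ((3 + β) / 2 * (1 + Hx) ^ 2)) := by
            rw [Finset.sum_const, Finset.card_univ, Fintype.card_fin, nsmul_eq_mul]
    have hle1 : 1 / ((N : ℝ) - 1) ≤ 1 := by rw [div_le_one (by linarith)]; exact hN1
    calc 1 / ((N : ℝ) - 1) * |∑ i : Fin N, (pinnedChain ω₂ lam β γ).bondCurrent N i x|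
        ≤ 1 * (N * (N * ((3 + β) / 2 * (1 + Hx) ^ 2))) := mul_le_mul hle1 hs (abs_nonneg _) zero_le_one
      _ = _ := one_mul _
  have hNT : 0 ≤ (N : ℝ) * T := by positivity
  have h3 : γ * (N * T + 2 * Hx) ≤ γ * (N * T + 2) * (1 + Hx) ^ 2 := by
    rw [mul_assoc]
    refine mul_le_mul_of_nonneg_left ?_ hγ
    nlinarith [mul_nonneg hNT hH0, mul_nonneg hNT (sq_nonneg Hx), sq_nonneg Hx, hH0]
  calc |(∑ i : Fin N, if i.val = 0 then γ * (T - x.2 i ^ 2) else 0)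
        - (1 / ((N : ℝ) - 1)) * ∑ i : Fin N, (pinnedChain ω₂ lam β γ).bondCurrent N i x|
      ≤ |∑ i : Fin N, (if i.val = 0 then γ * (T - x.2 i ^ 2) else 0)| +
        |1 / ((N : ℝ) - 1) * ∑ i : Fin N, (pinnedChain ω₂ lam β γ).bondCurrent N i x| := abs_sub _ _
    _ ≤ γ * (N * T + 2 * Hx) + N * (N * ((3 + β) / 2 * (1 + Hx) ^ 2)) := add_le_add h1 h2
    _ ≤ γ * (N * T + 2) * (1 + Hx) ^ 2 + N * (N * ((3 + β) / 2 * (1 + Hx) ^ 2)) := add_le_add h3 le_rfl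
    _ = (γ * (N * T + 2) + N * (N * ((3 + β) / 2))) * (1 + Hx) ^ 2 := by ring

/-- **The truncation error for `E_L`.** For the pinned chain (`ω₂, lam, β, γ ≥ 0`, `N ≥ 2`, equal bath temperatures
`T ≥ 0`) there is `A ≥ 0` with `|L(E_L χ(H/R)) - χ(H/R) L E_L| ≤ (A/R) (1 + H)²` on phase space for all `R ≥ 1`:
by `generator_mul_smoothCutoff_hamiltonian` the difference is `E_L Lχ_R + Γ(E_L, χ_R)`, where `∂_{p₀}E_L = p₀`,
`∂_{p_{N-1}}E_L = 0`, `|χ'|, |χ''|` are bounded, `0 ≤ E_L ≤ H`, `p₀² ≤ 2H`, `p₀² + p²_{N-1} ≤ 4H`. [folklore] -/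
theorem pinnedChain_abs_generator_truncLeftEnergy_sub_le (hω : 0 ≤ ω₂) (hl : 0 ≤ lam) (hβ : 0 ≤ β) (hγ : 0 ≤ γ)
    (hN : 2 ≤ N) {T : ℝ} (hT : 0 ≤ T) :
    ∃ A : ℝ, 0 ≤ A ∧ ∀ R : ℝ, 1 ≤ R → ∀ x : PhaseSpace N,
      |(pinnedChain ω₂ lam β γ).generator N T T (fun y =>
            ((pinnedChain ω₂ lam β γ).hamiltonian N y - energyMoment (pinnedChain ω₂ lam β γ) N y / ((N : ℝ) - 1)) *
            smoothCutoff ((pinnedChain ω₂ lam β γ).hamiltonian N y / R)) x -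
          smoothCutoff ((pinnedChain ω₂ lam β γ).hamiltonian N x / R) *
            (pinnedChain ω₂ lam β γ).generator N T T (fun y =>
              (pinnedChain ω₂ lam β γ).hamiltonian N y - energyMoment (pinnedChain ω₂ lam β γ) N y / ((N : ℝ) - 1)) x| ≤
        A / R * (1 + (pinnedChain ω₂ lam β γ).hamiltonian N x) ^ 2 := by
  -- adapted from `pinnedChain_abs_generator_truncSiteEnergy_sub_le` (Theorems/…SiteEnergyDynkin.lean)
  obtain ⟨M₁, hM₁0, hM₁⟩ := SubdiffusiveBondHeat.exists_bound_deriv_smoothCutoff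
  obtain ⟨M₂, hM₂0, hM₂⟩ := SubdiffusiveBondHeat.exists_bound_deriv_deriv_smoothCutoff
  refine ⟨γ * (7 * M₁ * T + 6 * M₁ + 6 * M₂ * T), by positivity, fun R hR x => ?_⟩
  have hN0 : 0 < N := by omega
  have hR0 : 0 < R := lt_of_lt_of_le one_pos hR
  have hTγ : 0 ≤ (pinnedChain ω₂ lam β γ).γ * T := mul_nonneg hγ hT
  have hU2 : ContDiff ℝ 2 (pinnedChain ω₂ lam β γ).U := pinnedChain_contDiff_U ω₂ lam β γ
  have hV2 : ContDiff ℝ 2 (pinnedChain ω₂ lam β γ).V := pinnedChain_contDiff_V ω₂ lam β γ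
  have he2 : ContDiff ℝ 2 (fun y : PhaseSpace N =>
      (pinnedChain ω₂ lam β γ).hamiltonian N y - energyMoment (pinnedChain ω₂ lam β γ) N y / ((N : ℝ) - 1)) :=
    ((pinnedChain ω₂ lam β γ).contDiff_hamiltonian hU2 hV2 N).sub
      ((contDiff_energyMoment_of_contDiff _ hU2 hV2).div_const _)
  have hγ' : (pinnedChain ω₂ lam β γ).γ = γ := rfl
  have hN1 : (0 : ℝ) < (N : ℝ) - 1 := by
    have : (2 : ℝ) ≤ N := by exact_mod_cast hN
    linarith
  have hlast : (1 - (((⟨N - 1, Nat.sub_lt hN0 one_pos⟩ : Fin N).val : ℝ)) / ((N : ℝ) - 1)) = 0 := by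
    have h : (((⟨N - 1, Nat.sub_lt hN0 one_pos⟩ : Fin N).val : ℝ)) = (N : ℝ) - 1 := by
      simp only [Nat.cast_sub (show 1 ≤ N by omega), Nat.cast_one]
    rw [h, div_self hN1.ne', sub_self]
  have hfirst : (1 - (((⟨0, hN0⟩ : Fin N).val : ℝ)) / ((N : ℝ) - 1)) = 1 := by simp
  rw [generator_mul_smoothCutoff_hamiltonian hU2 hV2 hN0 hTγ hTγ he2 R x,
    partialP_leftEnergy _ hU2 hV2, partialP_leftEnergy _ hU2 hV2, hlast, hfirst, hγ', add_sub_cancel_left]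
  -- the elementary bounds
  obtain ⟨hE0, hEH1⟩ := pinnedChain_leftEnergy_nonneg_le hω hl hβ γ hN x
  have hH0 : 0 ≤ (pinnedChain ω₂ lam β γ).hamiltonian N x := pinnedChain_hamiltonian_nonneg hω hl hβ γ N x
  have hU0 : ∀ q, 0 ≤ (pinnedChain ω₂ lam β γ).U q := fun q => by
    show 0 ≤ ω₂ * q ^ 2 / 2 + lam * q ^ 4 / 4; positivity
  have hV0 : ∀ r, 0 ≤ (pinnedChain ω₂ lam β γ).V r := fun r => by
    show 0 ≤ r ^ 2 / 2 + β * r ^ 4 / 4; positivity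
  have hne : (⟨N - 1, Nat.sub_lt hN0 one_pos⟩ : Fin N) ≠ ⟨0, hN0⟩ := by
    intro h
    have := congrArg Fin.val h
    simp only at this
    omega
  have haH : x.2 ⟨0, hN0⟩ ^ 2 ≤ 2 * (pinnedChain ω₂ lam β γ).hamiltonian N x := by
    have h1 := (pinnedChain ω₂ lam β γ).site_le_hamiltonian hU0 hV0 N x ⟨0, hN0⟩
    have h2 := hU0 (x.1 ⟨0, hN0⟩)
    linarith
  have habH : x.2 ⟨0, hN0⟩ ^ 2 + x.2 ⟨N - 1, Nat.sub_lt hN0 one_pos⟩ ^ 2 ≤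
      4 * (pinnedChain ω₂ lam β γ).hamiltonian N x := by
    have := pinnedChain_sq_add_sq_le_hamiltonian hω hl hβ γ N x hne.symm
    linarith
  have hχ₁b := hM₁ ((pinnedChain ω₂ lam β γ).hamiltonian N x / R)
  have hχ₂b := hM₂ ((pinnedChain ω₂ lam β γ).hamiltonian N x / R)
  -- make the atoms opaque
  generalize deriv smoothCutoff ((pinnedChain ω₂ lam β γ).hamiltonian N x / R) = χ₁ at hχ₁b ⊢
  generalize deriv (deriv smoothCutoff) ((pinnedChain ω₂ lam β γ).hamiltonian N x / R) = χ₂ at hχ₂b ⊢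
  generalize (pinnedChain ω₂ lam β γ).hamiltonian N x -
    energyMoment (pinnedChain ω₂ lam β γ) N x / ((N : ℝ) - 1) = E at hE0 hEH1 ⊢
  generalize (pinnedChain ω₂ lam β γ).hamiltonian N x = Hx at hH0 haH habH hEH1 ⊢
  generalize x.2 ⟨0, hN0⟩ = p at haH habH ⊢
  generalize x.2 ⟨N - 1, Nat.sub_lt hN0 one_pos⟩ = q at habH ⊢
  have hEH : E ≤ 3 / 2 * Hx := by linarith
  -- real arithmetic: everything carries a factor `γ/R`
  have hb0 : 0 ≤ q ^ 2 := sq_nonneg _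
  have ha0 : 0 ≤ p ^ 2 := sq_nonneg _
  have key : E * (γ * (χ₁ / R * (T + T - p ^ 2 - q ^ 2) + χ₂ / R ^ 2 * (T * p ^ 2 + T * q ^ 2))) +
      χ₁ / R * (2 * γ * T * p * (1 * p) + 2 * γ * T * q * (0 * q)) =
      γ / R * (E * (χ₁ * (2 * T - p ^ 2 - q ^ 2) + χ₂ * T * (p ^ 2 + q ^ 2) / R) + χ₁ * (2 * T * p ^ 2)) := by
    field_simp; ring
  have hin : |E * (χ₁ * (2 * T - p ^ 2 - q ^ 2) + χ₂ * T * (p ^ 2 + q ^ 2) / R) + χ₁ * (2 * T * p ^ 2)| ≤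
      E * (M₁ * (2 * T + p ^ 2 + q ^ 2) + M₂ * T * (p ^ 2 + q ^ 2)) + M₁ * (2 * T * p ^ 2) := by
    have h1 : |χ₁ * (2 * T - p ^ 2 - q ^ 2)| ≤ M₁ * (2 * T + p ^ 2 + q ^ 2) := by
      rw [abs_mul]
      refine mul_le_mul hχ₁b ?_ (abs_nonneg _) hM₁0
      rw [abs_le]; constructor <;> linarith
    have h2 : |χ₂ * T * (p ^ 2 + q ^ 2) / R| ≤ M₂ * T * (p ^ 2 + q ^ 2) := by
      rw [abs_div, abs_mul, abs_mul, abs_of_nonneg hT, abs_of_nonneg (add_nonneg ha0 hb0), abs_of_pos hR0]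
      calc |χ₂| * T * (p ^ 2 + q ^ 2) / R ≤ |χ₂| * T * (p ^ 2 + q ^ 2) / 1 :=
            div_le_div_of_nonneg_left (by positivity) one_pos hR
        _ ≤ M₂ * T * (p ^ 2 + q ^ 2) := by
            rw [div_one]
            exact mul_le_mul_of_nonneg_right (mul_le_mul_of_nonneg_right hχ₂b hT) (add_nonneg ha0 hb0)
    have h3 : |χ₁ * (2 * T * p ^ 2)| ≤ M₁ * (2 * T * p ^ 2) := by
      rw [abs_mul, abs_of_nonneg (by positivity : (0:ℝ) ≤ 2 * T * p ^ 2)]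
      exact mul_le_mul_of_nonneg_right hχ₁b (by positivity)
    calc |E * (χ₁ * (2 * T - p ^ 2 - q ^ 2) + χ₂ * T * (p ^ 2 + q ^ 2) / R) + χ₁ * (2 * T * p ^ 2)|
        ≤ |E * (χ₁ * (2 * T - p ^ 2 - q ^ 2) + χ₂ * T * (p ^ 2 + q ^ 2) / R)| + |χ₁ * (2 * T * p ^ 2)| :=
          abs_add_le _ _
      _ = E * |χ₁ * (2 * T - p ^ 2 - q ^ 2) + χ₂ * T * (p ^ 2 + q ^ 2) / R| + |χ₁ * (2 * T * p ^ 2)| := by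
          rw [abs_mul, abs_of_nonneg hE0]
      _ ≤ E * (|χ₁ * (2 * T - p ^ 2 - q ^ 2)| + |χ₂ * T * (p ^ 2 + q ^ 2) / R|) + |χ₁ * (2 * T * p ^ 2)| := by
          gcongr
          exact abs_add_le _ _
      _ ≤ E * (M₁ * (2 * T + p ^ 2 + q ^ 2) + M₂ * T * (p ^ 2 + q ^ 2)) + M₁ * (2 * T * p ^ 2) := by
          gcongr
  have hpoly : E * (M₁ * (2 * T + p ^ 2 + q ^ 2) + M₂ * T * (p ^ 2 + q ^ 2)) + M₁ * (2 * T * p ^ 2) ≤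
      (7 * M₁ * T + 6 * M₁ + 6 * M₂ * T) * (1 + Hx) ^ 2 := by
    have s1 : E * (M₁ * (2 * T + p ^ 2 + q ^ 2) + M₂ * T * (p ^ 2 + q ^ 2)) ≤
        (3 / 2 * Hx) * (M₁ * (2 * T + 4 * Hx) + M₂ * T * (4 * Hx)) := by
      refine mul_le_mul hEH ?_ (by positivity) (by positivity)
      have := mul_nonneg hM₂0 hT
      nlinarith
    have s2 : M₁ * (2 * T * p ^ 2) ≤ M₁ * (2 * T * (2 * Hx)) :=
      mul_le_mul_of_nonneg_left (mul_le_mul_of_nonneg_left haH (by positivity)) hM₁0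
    nlinarith [mul_nonneg hM₁0 hT, mul_nonneg (mul_nonneg hM₁0 hT) hH0, mul_nonneg hM₁0 hH0,
      mul_nonneg (mul_nonneg hM₁0 hT) (sq_nonneg Hx), mul_nonneg hM₂0 hT,
      mul_nonneg (mul_nonneg hM₂0 hT) hH0]
  rw [key, abs_mul, abs_div, abs_of_nonneg hγ, abs_of_pos hR0]
  calc γ / R * |E * (χ₁ * (2 * T - p ^ 2 - q ^ 2) + χ₂ * T * (p ^ 2 + q ^ 2) / R) + χ₁ * (2 * T * p ^ 2)|
      ≤ γ / R * (E * (M₁ * (2 * T + p ^ 2 + q ^ 2) + M₂ * T * (p ^ 2 + q ^ 2)) + M₁ * (2 * T * p ^ 2)) :=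
        mul_le_mul_of_nonneg_left hin (div_nonneg hγ hR0.le)
    _ ≤ γ / R * ((7 * M₁ * T + 6 * M₁ + 6 * M₂ * T) * (1 + Hx) ^ 2) :=
        mul_le_mul_of_nonneg_left hpoly (div_nonneg hγ hR0.le)
    _ = γ * (7 * M₁ * T + 6 * M₁ + 6 * M₂ * T) / R * (1 + Hx) ^ 2 := by ring

/-- **The truncation error for `E_L`, closed form** (registered sub-goal of `stub_dynkinLeftEnergy`; closed form of
`pinnedChain_abs_generator_truncLeftEnergy_sub_le`): for the pinned chain (`ω₂, lam, β, γ ≥ 0`, `N ≥ 2`, equal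
bath temperatures `T ≥ 0`) there is `A ≥ 0` with `|L(E_L χ(H/R)) - χ(H/R) L E_L| ≤ (A/R) (1 + H)²` for all
`R ≥ 1`. [folklore] -/
theorem stub_dynkinLeftEnergy_truncationError :
    ∀ ω₂ lam β γ : ℝ, 0 ≤ ω₂ → 0 ≤ lam → 0 ≤ β → 0 ≤ γ → ∀ T : ℝ, 0 ≤ T → ∀ N : ℕ, 2 ≤ N →
    ∃ A : ℝ, 0 ≤ A ∧ ∀ R : ℝ, 1 ≤ R → ∀ x : PhaseSpace N,
      |(pinnedChain ω₂ lam β γ).generator N T T (fun y : PhaseSpace N =>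
            ((pinnedChain ω₂ lam β γ).hamiltonian N y - energyMoment (pinnedChain ω₂ lam β γ) N y / ((N : ℝ) - 1)) *
            smoothCutoff ((pinnedChain ω₂ lam β γ).hamiltonian N y / R)) x -
          smoothCutoff ((pinnedChain ω₂ lam β γ).hamiltonian N x / R) *
            (pinnedChain ω₂ lam β γ).generator N T T (fun y : PhaseSpace N =>
              (pinnedChain ω₂ lam β γ).hamiltonian N y - energyMoment (pinnedChain ω₂ lam β γ) N y / ((N : ℝ) - 1)) x| ≤
        A / R * (1 + (pinnedChain ω₂ lam β γ).hamiltonian N x) ^ 2 := by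
  intro ω₂ lam β γ hω hl hβ hγ T hT N hN
  exact pinnedChain_abs_generator_truncLeftEnergy_sub_le hω hl hβ hγ hN hT

end Summit.AtomisticToContinuum.FouriersLaw.Theorems.OddSectorIrreversibility

end
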